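import Mathlib
import HarnessLib
import HarnessLib.Audit
import Summits.CriticalPhenomena.Statement
import Literature.Probability.RandomPlanarGeometry.ChordalCurveFamily
import Literature.Probability.RandomPlanarGeometry.ConformalRestrictionHolds
import HarnessLib.Audit.Status.Attr

/-!
Route: SAWCutPointCondensation

DORMANT since 2026-08-22T04:35:51Z (reconciler: no traction for 5.1 d (last activity item-evidence-added at 2026-08-17T02:24:27Z); parked, not closed — `ledger route dormant route-CriticalPhenomena-SAWCutPointCondensation --off` to reac) — unstaffed, not closed; items shared with open routes are served there. `ledger route dormant <id> --off` reactivates.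

# Route SAWCutPointCondensation — condense the cut points — blob-time-penalised random walk,
Brownian at t = 1, SAW.law at t = 0, SLE(8/3) as the infrared end of a relevant flow

It suffices to show X = (W) ∧ (S) ∧ (C) ∧ (U) — idea card condense-the-cut-points ("the
self-avoiding walk is what the random walk becomes when its cut times are rewarded until they
condense") made crux-first. Objects (ℤ²-native, positive weights, all INLINED in the items;
definition requests filed to shorten them): for a nearest-neighbour walk p of length n, j < n is a
CUT TIME if p[0,j] ∩ p[j+1,n] = ∅; the BLOB TIME is B(p) := n − #{cut times} (B = 0 iff p is
self-avoiding); for a blob fugacity t ∈ [0,1] (t = e^{−λ}) put b_n(t) := Σ_{|ω|=n, ω(0)=0} t^{B(ω)}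
on ℤ² (submultiplicative), μ_B(t) := inf_n b_n(t)^{1/n} ∈ [max(4t, μ), 4], y_c(t) := 1/μ_B(t)
(y_c(1) = 1/4, y_c(0) = x_c = 1/μ), and BL_t(Ω_δ; a, b) := the probability law ∝ Σ_p y_c(t)^{|p|}
t^{B(p)} δ_{curve(p)} over ALL walks p of Ω_δ from a to b, pushed to CurveClass ℂ —
restriction-exact for every t (the weight is a function of the path), BL_1 = the random-walk
excursion law (Brownian excursion in the limit, a theorem), BL_0 = SAW.law pushed to curves (support
BlobZeroIsSAW).
 (W) CutPointWindowLimit — in the NEAR-BROWNIAN WINDOW t = exp(−g δ^{3/4}) (3/4 = 2 − ξ(1,1) =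
dimension of the Brownian cut points, LawlerSchrammWerner2001PlaneExponents; δ^{3/4}·#cut points →
Minkowski content, GaoLiPanovShiraishi2026 / HoldenLawlerLiSun2022) the laws BL converge as δ → 0+
to a chordal law Q_g(D), for every g > 0;
 (S) CondensationLimit — Q_g → P as g → ∞, P chordal with the two-sided restriction property,
carried by simple curves meeting ∂D only at a, b ("the blobs die in the infrared");
 (C) CondensateCovariance — every such P is conformally covariant: the pointwise-critical
inhomogeneous tilts (coupling g|ψ′|^{3/4}, killing θ|ψ′|²) form a conformally CLOSED class with NO
counterterm because (3/4)·(8/3) = 2, so covariance = insensitivity of the infrared end to bounded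
log-harmonic coupling profiles (a relevant bare coupling is forgotten);
 (U) PenaltyUniversality — on δℤ², any two fugacity schedules t_i(δ) ∈ [0,1] with −log
t_i(δ)/δ^{3/4} → ∞ (fixed t < 1, slowly closing windows, and t ≡ 0 = the SAW itself) give
asymptotically equal laws in every Dobrushin domain.
Then the in-tree THEOREM Literature.Probability.RandomPlanarGeometry.LawlerSchrammWerner2003_holds
(LSW03 p.5 result 2) identifies P(D) as the chordal SLE_{8/3} law, a diagonal schedule g(δ) → ∞
through (W),(S) (support ScheduleExtraction, shared) plus (U) with t₂ ≡ 0 and BlobZeroIsSAW carries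
SAW.law to SLE_{8/3}: SAWScalingLimit. The calibration crux FreeEnergyScaling (p(λ) ≍ λ^{8/3}, a
theorem about planar simple random walk) pins the window exponent of (W).
Lean: `CutPointWindowLimit ∧ CondensationLimit ∧ CondensateCovariance ∧ PenaltyUniversality`

## Assembly
Bookkeeping, no mathematics hidden (checked on paper against the exact signatures; every constant
elaborates in SketchInline.lean, lean check rc 0): fix (D; a, b) and an endpoint approximation h. By
choice over g > 0 turn CutPointWindowLimit into Q : ℝ → ChordalFamily with the window property (Q g
:= anything chordal for g ≤ 0); CondensationLimit Q gives P (chordal, restriction, simple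
boundary-avoiding, Q g D → P D on approximable domains); CondensateCovariance gives
P.IsConformallyCovariant; the IN-TREE THEOREM
Literature.Probability.RandomPlanarGeometry.LawlerSchrammWerner2003_holds
(ConformalRestrictionHolds.lean; covariance/restriction clauses are Iff.rfl-unfoldings
isConformallyCovariant_iff / isRestriction_iff) yields IsSLELaw (8/3) D (P D) = ∃ Γ, IsSLECurve
(8/3) D Γ ∧ P D = preWienerMeasure.map Γ (Γ a.e.-measurable by IsSLECurve.1). ScheduleExtraction
with F g δ := BL_{exp(−gδ^{3/4})}(Ω_δ; a_δ, b_δ), A g := Q g D, P := P D (dichotomy by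
BlobLawDichotomy at t = exp(−gδ^{3/4}); F ⇒ A g is the TendstoLaw clause with the identity variable,
definitional) gives gs → ∞ with F (gs δ) δ ⇒ P D; PenaltyUniversality with t₁ δ := exp(−(gs
δ)·δ^{3/4}) (eventually in [0,1] since gs δ ≥ 0 eventually; ≤ exp(−Mδ^{3/4}) as soon as gs δ ≥ M)
and t₂ ≡ 0 gives ∫ f dBL_0 → ∫ f dP D; BlobZeroIsSAW + integral_map (SAW.aemeasurable_curve) rewrite
this as TendstoLaw (fun δ γ => γ.curve) (SAW.law) Γ ℙ, and with the eventual AEMeasurable clause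
(aemeasurable_curve) this is ConvergesInLawToSLE (8/3) D, i.e. SAWScalingLimit. No SLE named fact is
a hypothesis: exists_isSLECurve_eightThirds, IsSLECurve.map_eq_holds and
LawlerSchrammWerner2003_holds are theorems in the tree, so the shared support LSWRestrictionFact
(stmt-0775, which carries the unproved blanket hypothesis exists_isSLECurve for all κ) is
deliberately NOT in the chain.

Rationale: WHY THIS LINE. A FLOW BETWEEN TWO FIXED POINTS instead of a guess at one: the blob-time family
{BL_t} is restriction-exact at every coupling on the lattice (so LawlerSchrammWerner2003Restriction
applies to any simple boundary-avoiding limit and κ = 8/3, 5/8 are OUTPUT), sits on the random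
walk's own path space with positive weights, has the strongest available theorem at one end (RW
excursion → Brownian excursion, with Brownian motion's conformal invariance) and is LITERALLY the
conjunct's measure SAW.law at the other (t = 0) — no comparison family, no observable, no integrable
weights. What drives the flow is a RELEVANT operator: the residual of B after the thermal part is
the cut-point content, of dimension y = 3/4 > 0 (Lawler1996CutTimes Thm 1.3 +
LawlerSchrammWerner2001PlaneExponents ξ(1,1) = 5/4; natural measure HoldenLawlerLiSun2022, lattice
convergence GaoLiPanovShiraishi2026 Thm 1.1), so every t < 1 flows AWAY from Brownian motion with
crossover length (−log t)^{−4/3}, the near-Brownian window is t = 1 − O(δ^{3/4}), and the critical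
fugacity shift is a finite continuum killing rate exactly when p(λ) ≍ λ^{8/3} (crux
FreeEnergyScaling) — this is what separates the line from the Domb–Joyce/Edwards tilt of route
SAWEdwardsStrongCoupling, whose pair interaction is MARGINAL in the plane
(Literature.Barriers.CriticalPhenomena.PlanarEdwardsModelDiffusive: absolutely continuous w.r.t.
Wiener at every coupling, log counterterm in the covariance class), and from every LERW-anchored
sibling (SAWChargeContinuation, SAWLoopAvoidanceChaos: fractional powers of massless determinants
along a marginal line). Imported areas, with the dictionary scale R ↦ coupling R^{3/4}g, conformal
map ↦ coupling PROFILE g|ψ′|^{3/4}, criticality ↦ killing κ₀g^{8/3}: intersection exponents and cut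
points of planar Brownian motion / SRW (Lawler1991, Lawler1996CutTimes,
Lawler2005ConformallyInvariant ch. 8, Virag2003 beads, HoldenLawlerLiSun2022,
GaoLiPanovShiraishi2026), strong approximation (KMT/Skorokhod), large deviations of an
additive-under-concatenation path functional (Fekete; the cut-time free energy p = I*), conformal
restriction (LawlerSchrammWerner2003Restriction, Werner2005ConformalRestriction), weak convergence
on the Polish curve space (CurveClass.polishSpace_holds). Against the negatives index: no tightness
item is filed (stmt-CriticalPhenomena-0772); every δ-quantifier is along 𝓝[>]0.

RANKED CRUXES. #2 CondensationLimit (crux) — (card r2, CONDENSATION = existence of the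
strong-coupling limit) For every family Q : ℝ → ChordalFamily such that, for each g > 0, Q g is
chordal (ChordalFamily.IsChordal) and is the δ → 0+ weak limit (TendstoLaw, identity random
variable) of the critical blob-time laws BL_{exp(−gδ^{3/4})}(Ω_δ; a_δ, b_δ) for every Dobrushin
domain and every endpoint approximation
(Literature.Probability.RandomPlanarGeometry.SAW.IsEndpointApprox) — i.e. Q is the window family of
CutPointWindowLimit — there is a chordal family P with the two-sided restriction property
(ChordalFamily.IsRestriction), carried by simple curves meeting ∂D only at a, b (CurveClass.simple,
range ∩ frontier D ⊆ {a, b}), such that Q g D → P D weakly as g → ∞ (bounded continuous test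
functions) on every approximable Dobrushin domain. 'Reward the cut points until they condense: the
blobs between consecutive cut points die in the infrared.' Tools foreseen: exact restriction at
every g (lattice identity passed to the window limit); zoom = flow (Q_g on R·D is the R-image of
Q_{R^{3/4}g} on D, so g → ∞ in D is the large-domain limit at fixed g); Virág's bead decomposition
of the excursion at its cut times (tilting by cut local time and duration keeps the bead process
Poissonian with an exponentially KILLED bead law, so g → ∞ is a deterministic thinning of large
beads); annulus-crossing bounds uniform in g. [deps: CutPointWindowLimit] [difficulty: open-problem]
(why it might fail: An intermediate 'beaded' fixed point: macroscopic blobs could survive g → ∞ in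
the continuum (no lattice cutoff prices a blob at a definite amount), or tightness/simplicity
uniform in g fails (KS-type crossing bounds are unproved even for the SAW).) [Virag2003,
LawlerSchrammWerner2003Restriction, Werner2005ConformalRestriction, KemppainenSmirnov2017,
MadrasSlade1993, HoldenLawlerLiSun2022]
#3 CondensateCovariance (crux) — (card r2, covariance half = bare-coupling irrelevance at the
infrared end) For every window family Q (as in CondensationLimit) and every chordal P with the
restriction property, carried by simple curves meeting ∂D only at a, b, such that Q g D → P D weakly
as g → ∞ on every approximable Dobrushin domain: P is conformally covariant
(ChordalFamily.IsConformallyCovariant). Intended proof: conformal invariance of the Brownian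
excursion, covariance of the cut-point content (d𝓜′ = |φ′|^{3/4} d𝓜) and of duration (dτ′ = |φ′|²
dτ) make the POINTWISE-CRITICAL inhomogeneous tilts exp(∫ gρ d𝓜 − κ₀ ∫ (gρ)^{8/3} dτ)·(excursion
law) a conformally CLOSED class — exactly, with no counterterm, since (3/4)·(8/3) = 2 turns the
profile ρ = |ψ′|^{3/4} of the coupling into the profile |ψ′|² of the killing — so covariance of the
strong-coupling limit IS profile universality: lim_{g→∞} of the ρ-modulated family equals lim_{g→∞}
of the constant one for log-harmonic ρ bounded above and below on compacts (plus exact restriction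
to localise away from rough prime ends). The bare value of a RELEVANT coupling sets only the local
crossover scale (gρ)^{−4/3} → 0 and is forgotten in the infrared. [deps: CutPointWindowLimit,
CondensationLimit] [difficulty: open-problem] (why it might fail: |ψ′| degenerates at rough prime
ends and at a, b, outside bounded-profile universality; a marginal stress-tensor-type response to
∇log ρ could survive g → ∞ and leave a profile memory, so the limit would be restriction-covariant
but not conformally covariant.) [LawlerSchrammWerner2004SAW, HoldenLawlerLiSun2022,
Lawler2005ConformallyInvariant, Virag2003,
Literature.Barriers.CriticalPhenomena.ScaleCovarianceNotMoebius]
#4 PenaltyUniversality (crux) — (card r4, COMMUTATION, stated on the lattice) For every Dobrushin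
domain, endpoint approximation and two blob-fugacity schedules t₁ t₂ : ℝ → ℝ with, eventually along
δ → 0+, t_i(δ) ∈ [0,1] and, for every M, eventually t_i(δ) ≤ exp(−Mδ^{3/4}) (the effective window
coupling −log t_i(δ)/δ^{3/4} diverges: fixed t ∈ [0,1), slowly closing windows, and t ≡ 0 = the
self-avoiding walk itself, with no Real.log so that t = 0 is a genuine member), the critical
blob-time laws BL_{t₁(δ)} and BL_{t₂(δ)} in (Ω_δ; a_δ, b_δ) are asymptotically equal in law: ∫ f
dBL_{t₁(δ)} − ∫ f dBL_{t₂(δ)} → 0 for every bounded continuous f on CurveClass ℂ. 'Any positive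
price per unit of blob time flows to the self-avoiding walk, and the lattice adds nothing between
the window and t = 0': lim_δ SAW.law = lim_g lim_δ (window). On graphs whose RW-modulus differs from
the SAW-modulus this is false (card random-walk-ruler-needs-d4), so the content is 'no D₄-invariant
marginal operator is generated below the window'; on ℤ² the quarter-turn forbids the spin-2 one.
[difficulty: open-problem] (why it might fail: A double limit across the whole crossover: fixed t ∈
(0,1) is folklore-level open (like fixed-λ Domb–Joyce, BDGS2012 (1.28)); a log-slow window could
behave differently; any RW-vs-SAW modulus renormalisation surviving on ℤ² refutes it exactly as
typed.) [BDGS2012, KennedyLawler2013, LawlerSchrammWerner2004SAW, MadrasSlade1993,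
Literature.Barriers.CriticalPhenomena.EmbeddingModulusUniqueness]
#5 CutPointWindowLimit (crux) — (card r3, WINDOW — the construction statement positing the continuum
window family through its lattice characterisation; weak limits on the Polish space CurveClass ℂ are
unique) For every g > 0 there is a chordal family Q_g (probability laws carried by curves in D̄ from
a to b) such that for every Dobrushin domain (Ω; a, b) and every endpoint approximation the critical
blob-time law with fugacity t = exp(−g δ^{3/4}) — weight y_c(t)^{|p|} t^{B(p)} on ALL
nearest-neighbour walks p of Ω_δ from a_δ to b_δ (y_c(t) = 1/μ_B(t) the whole-plane critical
fugacity), normalised and pushed to curves — converges weakly to Q_g(D) as δ → 0+. Intended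
identification (once the excursion/cut-content definitions exist): Q_g(D) ∝ exp(g c₁ 𝓜_{3/4}(cut
points of ω) − θ_c(g) τ(ω)) · μ^{exc}_{D;a,b}(dω) with θ_c(g) = κ₀ g^{8/3} the whole-plane critical
killing rate; inputs in print: KMT/Skorokhod coupling, GaoLiPanovShiraishi2026 Thm 1.1–1.3
(ε^{3/4}·Σ_{cut points} δ_x of the SRW stopped on leaving the disc → the Minkowski-content measure
of the Brownian cut points, weakly in law and in L² under the coupling), HoldenLawlerLiSun2022 (the
content exists, non-atomic), Lawler1996CutTimes Thm 1.3 (non-intersection ≍ n^{−ζ} up to constants).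
[difficulty: XL] (why it might fail: GLPS: walk stopped in a disc, polynomial moments; here an
EXPONENTIAL tilt e^{gν} of an excursion pinned at prime ends at exact whole-plane criticality
y_c(t): if p(λ) ≁ λ^{8/3} or uniform exponential moments fail, mass escapes to long/short walks and
no chordal limit exists.) [GaoLiPanovShiraishi2026, HoldenLawlerLiSun2022, Lawler1996CutTimes,
LawlerSchrammWerner2001PlaneExponents, Virag2003, arXiv:2310.09592]
#6 FreeEnergyScaling (crux) — (card r5(b): the relevance exponent as a theorem about planar simple
random walk; calibrates the window δ^{3/4} of CutPointWindowLimit and is the line's cheapest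
analytic test) The cut-time free energy p(λ) := lim_n n⁻¹ log E_SRW[e^{λ C_n}] (C_n = #cut times of
the n-step walk; exists by submultiplicativity) equals log(μ_B(t)/(4t)) at t = e^{−λ} and satisfies
p ≍ λ^{8/3} at 0+: there are c, C, ε > 0 with c(1−t)^{8/3} ≤ log(μ_B(t)/(4t)) ≤ C(1−t)^{8/3} for all
t ∈ (1−ε, 1). Here 8/3 = 2/y, y = 3/4 = 2 − ξ(1,1): the correlation TIME of the reward λ is
λ^{−8/3}. Upper bound ⇐ SOME exponential moment of C_n/n^{3/8} bounded uniformly in n (k-point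
bounds of the Lawler1996CutTimes / GaoLiPanovShiraishi2026 Prop 5.1 type) + submultiplicativity E
e^{λC_{n+m}} ≤ E e^{λC_n} E e^{λC_m}, choosing n₀ = (s₀/λ)^{8/3}; lower bound ⇐ a drift strategy
(speed v costs ≍ v² per step in entropy and produces cut-time density ≍ v^{2ζ} = v^{5/4}, so the
rate function of the cut density obeys I(c) ≲ c^{8/5}, Legendre-dual to 8/3). Endpoint check: μ_B(0)
= μ, i.e. I(1) = log(4/μ). [difficulty: L] (why it might fail: Uniform exponential moments of
n^{−3/8}C_n and the drifted-walk cut density ≍ v^{5/4} are unproved; a logarithmic correction (c =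
0) would spoil the pure power 8/3 and shift the window of CutPointWindowLimit.) [Lawler1996CutTimes,
LawlerSchrammWerner2001PlaneExponents, GaoLiPanovShiraishi2026, Lawler1991]
#9 BlobZeroIsSAW (support) — At t = 0 the inlined critical blob-time law IS the conjunct's law
pushed to curves: BL_0(Ω_δ; a, b) = (SAW.law Ω δ a b).map (·.curve) for all Ω, δ, a, b. Proof: B(p)
= 0 ↔ every j < |p| is a cut time ↔ p.getVert injective on [0, |p|] ↔ p.IsPath; hence (0:ℝ)^{B(p)} =
𝟙{IsPath}, b_n(0) = (count n : ℝ), μ_B(0) = SAW.connectiveConstant and y_c(0) = criticalFugacity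
definitionally; reindex Measure.sum over {p // p.IsPath} ≃ DomainSAW Ω δ a b (terms with ¬IsPath
vanish), map commutes with sum/smul/dirac; junk cases agree since total masses coincide (cf.
SAWEdwardsStrongCoupling.WeaklyOneIsSAW, planner-proved there). [difficulty: provable-now]
[LawlerSchrammWerner2004SAW, BDGS2012]
#9 BlobLawDichotomy (support) — The inlined law (S univ)⁻¹ • S is either the zero measure (S univ ∈
{0, ∞}) or a probability measure, for every real t and all Ω, δ, a, b — pure ENNReal normalisation
algebra (ENNReal.inv_top, ENNReal.inv_mul_cancel); the same 10-line generic lemma closes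
SAWEdwardsStrongCoupling.WindowLawDichotomy. (For t ∈ [0,1], bounded Ω and δ > 0 the total mass is
in fact finite and, once a, b are joined, positive: #cut times ≤ |V(Ω_δ)| gives weight ≤
t^{−|V|}(t·y_c(t))^{|p|} with t·y_c(t) ≤ 1/4 < 1/λ₁(Ω_δ).) [difficulty: provable-now] [BDGS2012,
folklore (Mathlib ENNReal.inv_top / ENNReal.inv_mul_cancel)]
#9 BlobCountSubmult (support) — Submultiplicativity of the whole-plane blob partition sums:
b_{n+m}(t) ≤ b_n(t)·b_m(t) for t ∈ [0,1] and all n, m (split an (n+m)-step walk from 0 at time n and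
translate the tail to the origin — an injection; a cut time of the concatenation is a cut time of
the piece containing it, so B is superadditive and t^B submultiplicative on [0,1], including t = 0;
endpoints of k-step walks lie in box 2 k). Consequences for provers of the cruxes: μ_B(t) = lim
b_n^{1/n} (Fekete, Mathlib Subadditive.tendsto_lim), b_n(t) ≥ μ_B(t)^n, 4t ≤ μ_B(t) ≤ 4, μ_B(0) = μ:
the critical fugacity y_c(t) is a genuine number in [1/4, 1/μ]. [difficulty: provable-now]
[BDGS2012, MadrasSlade1993]
#9 ScheduleExtraction (support) — (shared verbatim with SAWEdwardsStrongCoupling,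
stmt-CriticalPhenomena-4655, planner-proved there) Diagonal schedule for iterated weak limits on
CurveClass ℂ: if F g δ ∈ {0} ∪ {probability measures}, F g δ ⇒ A g as δ → 0+ for every g > 0, A g
probability, and A g ⇒ P as g → ∞ (P probability), then there is a schedule gs with gs δ → ∞ as δ →
0+ and F (gs δ) δ ⇒ P (weak convergence of probability measures on a Polish space is metrisable:
Lévy–Prokhorov). [difficulty: provable-now] [Billingsley1999, Mathlib (MeasureTheory.LevyProkhorov
instMetrizableSpaceProbabilityMeasure)]

TWO-LAYER PLAN. Foreseen glued splits once a crux closes (k ≤ 3, depth 1; nothing filed now):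
CondensationLimit ⇐ TiltedExcursionTight (annulus crossings uniform in g) → LimitRestrictionSimple
(restriction passes to the limit; boundary touching is null) → CondensationLimit;
CondensateCovariance ⇐ ProfileWindowLimit (window limit with a log-harmonic coupling profile) →
ExactProfileCovariance (φ_* of the ρ-model on D is the ρ|ψ′|^{3/4}-model on D′, an identity) →
ProfileUniversality → CondensateCovariance; PenaltyUniversality ⇐ FixedFugacityUniversality (fixed t
< 1 vs t = 0) → ScheduleComparison (monotone coupling in t along the window) → PenaltyUniversality;
CutPointWindowLimit ⇐ ExcursionCutContent (GLPS for the excursion a → b in a Jordan domain, jointly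
with the path) → ExponentialMoments (uniform exponential moments of the rescaled cut count at
criticality) → CutPointWindowLimit; FreeEnergyScaling ⇐ upper (moments + Fekete) → lower (drift
construction).

KILL CRITERIA. ¬FreeEnergyScaling with a DIFFERENT power (p ≍ λ^α, α ≠ 8/3) refutes the relevance
bookkeeping: CutPointWindowLimit as typed is then miscalibrated (degenerate window) — pivot by
restating (W),(S),(C),(U) with window exponent 2/α (one `--restate` each, same decl names) if α is
identified, close `refuted:FreeEnergyScaling` if the witness shows p is not a pure power (log
corrections: the flow picture survives only informally). ¬CutPointWindowLimit by mass escape at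
exact criticality with a BOUNDED killing offset is harmless downstream (zoom covariance absorbs an
O(1) shift of θ) and is repaired by restating (W) with a shifted fugacity; by non-existence of any
window limit it closes the route as typed. ¬PenaltyUniversality with a fixed-t witness refutes 'any
positive blob price flows to SAW' and moots the lattice half (the continuum theorem (W)+(S)+(C) ⇒
'condensed cut-point excursion = SLE_{8/3}' survives as a stand-alone target); with a slow-window
witness, pivot to schedules −log t ≥ δ^{3/4−η}. ¬CondensationLimit (a beaded, non-simple infrared
limit) kills the line and is itself a discovery (a new restriction-covariant fixed point between BM
and SAW); ¬CondensateCovariance for an established P kills the line and the CI belief for the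
conjunct. Proved elsewhere: ConfCovLimit/RestrictionOfLimit of SAWConfRestriction or
CouplingUniversality-type results of SAWEdwardsStrongCoupling do not moot (W),(S); SAWScalingLimit
itself moots everything. Numerical κ-plateau ≠ 8/3 for BL_t at t = 1/2 (cheapest falsifier (i)) →
dormant.

NOT DECOMPOSED YET. Tightness and simplicity inside CondensationLimit (restriction formula for
tilted excursions, crossing bounds uniform in g); the profile split of CondensateCovariance (waits
for the definition BlobTime.domainLawProfile so children get short signatures); the fixed-t /
slow-schedule halves of PenaltyUniversality; inside CutPointWindowLimit: the excursion version of
GLPS (their walk is stopped on leaving a disc), joint convergence with the path, exponential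
moments, approximability of every Dobrushin domain by some IsEndpointApprox (convergence clauses Q g
D → P D are stated only on approximable domains, so no junk-valued Q can refute (S),(C)); exact
lattice restriction of BL_t for nested discrete domains (true at lattice level up to the meshDomain
largest-component convention; a prover's lemma via --supports); Carathéodory issues at rough prime
ends; the two directions of FreeEnergyScaling; the card's determinantal sibling B′ = |ω| − |LE ω|
(massive-LERW skeleton, ChelkakWan) and its percolation face (θ′-ISAW / SLE₆ double points) — other
routes if this one moves.

CHEAPEST FALSIFIER. (i) Monte-Carlo of BL_t at t = 1/2 (and t = 0.9) in a 300δ half-disc or strip,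
y_c(t) from series/transfer-matrix estimates of b_n(t) (C_n is computable in O(n) per walk with a
last-visit array): left-passage probability of an interior point vs Schramm's SLE_{8/3} formula and
P[walk avoids a boundary bump A] vs Φ′_A(a)^{5/8}Φ′_A(b)^{5/8}; a κ-plateau ≠ 8/3 beyond the
crossover scale (−log t)^{−4/3} kills CondensationLimit/PenaltyUniversality. (ii) Series: p(λ) =
log(μ_B(e^{−λ})/(4e^{−λ})) from exact enumeration of b_n(t), n ≤ 30, against λ^{8/3} (tests
FreeEnergyScaling, i.e. y = 3/4). (iii) E_exc[exp(g𝓜_{3/4} − θτ)] = ∞ for all θ would kill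
CutPointWindowLimit only. Not run here (compute-free hub, plancard unit without kit budget); (ii) is
the recommended first refuter action, (i) the second.

NUMBERS. κ = 8/3; restriction exponent 5/8 = ζ₂ = ξ(1,1)/2 (cut-time exponent: P(j is a cut time of
S[0,n]) ≍ n^{−5/8} in the bulk, E#cut times ≍ n^{3/8}, Lawler1996CutTimes +
LawlerSchrammWerner2001PlaneExponents); dim(Brownian cut points) = 2 − ξ(1,1) = 3/4 (Lawler 1996 EJP
1:2; Lawler2005ConformallyInvariant Thm 8.2/Prop 8.24) = the relevance eigenvalue y; window t = 1 −
gδ^{3/4}; crossover length ℓ(λ) = λ^{−4/3}, correlation time λ^{−8/3}; p(λ) ≍ λ^{8/3} ↔ I(c) ≍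
c^{8/5} (Legendre), I(1) = log(4/μ); GLPS normalisation ν_n = c₁ ε^{2−ξ} Σ_{cut points} δ_x, ε =
e^{−n}, 2 − ξ = 3/4 (arXiv:2310.09592 (1.4), Thm 1.1); μ_B(1) = 4, μ_B(0) = μ ∈ [2.625622, 2.679193]
(BDGS2012 (1.14)), 4t ≤ μ_B(t) ≤ 4; zoom covariance Q_g(R·D) = R_*Q_{R^{3/4}g}(D); profile closure
(3/4)·(8/3) = 2 (no counterterm, unlike Edwards' (2g/π)log R). Items at open: 10 (5 cruxes, 4
support, 1 assembly).

DEFINITION REQUESTS. To be filed right after open (topic Literature/Probability/RandomPlanarGeometry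
unless noted): BlobTime.cutCount / BlobTime.blobTime (SimpleGraph.Walk functional: #{j < |p| :
p[0,j] ∩ p[j+1,|p|] = ∅} and |p| − it; lemma blobTime = 0 ↔ IsPath), BlobTime.partitionSum /
BlobTime.connectiveConstant / BlobTime.criticalFugacity (b_n(t), μ_B(t) = ⨅ b_{n+1}^{1/(n+1)}, y_c =
μ_B⁻¹, next to SAW.Zd.weaklyConnectiveConstant in BDGS2012.lean style), BlobTime.domainLaw (the
inlined BL_t as a named Measure (CurveClass ℂ), with variant domainLawProfile for a site-dependent
fugacity t(z) — needed for the foreseen split of CondensateCovariance), and, for the intended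
identification in CutPointWindowLimit, ExcursionCutContent (continuum: Brownian excursion law
between the marked prime ends of a Dobrushin domain with the 3/4-Minkowski content of its cut
points, HoldenLawlerLiSun2022 / GaoLiPanovShiraishi2026 §6) so that (W) becomes an identification
theorem and (S),(C) can be restated on Wiener space. Cite facts wanted: GaoLiPanovShiraishi2026 Thm
1.1 and Prop 5.1; Lawler1996CutTimes Thm 1.3; HoldenLawlerLiSun2022 Thm 1.1 (existence, covariance
of the cut-point content).

Novelty: Searches (2026-08-15): `lit search --hybrid "cut points cut times simple random walk reward penalty
self-avoiding walk interpolation scaling limit"` (12 docs: MadrasSlade1993, Lawler1991/2012,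
Lawler2005 — none with the functional); `lit vsearch` of the mechanism sentence (12 docs, same
books); `lit galaxy search --star all` ×2 ("cut times for simple random walk" 0 rows; "Brownian cut
points" 2 irrelevant pdf rows); `lit search --source zbmath "cut points simple random walk"` (12:
Lawler 1996 EJP 1:13; Gao–Li–Panov–Shiraishi EJP 31 (2026) = arXiv:2310.09592, READ pp.1–3,17 and
refs; Shiraishi 2012/2018); OpenAlex/arXiv HTTP 429 (budget exhausted); plus the card's own searches
and its refuter audit (grade new-combination: genre = intrinsic Gibbs tilt of SRW maximal on SAWs,
Domb–Joyce/Edwards, Lawler1991 §6.4, MadrasSlade1993 §10.1; relevance of weak self-repulsion below d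
= 4, BDGS2012 §1.2).
Nearest prior art found: GaoLiPanovShiraishi2026 (arXiv:2310.09592) + HoldenLawlerLiSun2022 — the
untilted λ = 0 end: the rescaled cut-point occupation measure of planar SRW converges to the
Minkowski content of Brownian cut points (they announce the frontier analogue 'a variant of
SLE_{8/3}', not a tilt); Lawler1996CutTimes (cut-time counts ≍ n^{3/8}); MadrasSlade1993 §10.1 /
Lawler1991 §6.4 / route SAWEdwardsStrongCoupling (the Domb–Joyce–Edwards strong-coupling hope,
marginal functional); Virag2003 (beads of the untilted excursion).
Delta: a Gibbs tilt of the random walk by its BLOB T  [refs: 2310.09592, MadrasSlade1993, Lawler1991, Lawler2005, BDGS2012, GaoLiPanovShiraishi2026, HoldenLawlerLiSun2022, Virag2003]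

Barriers (technique_class: relevant-crossover, intrinsic-tilt, exact-restriction): - technique_class: relevant-crossover, intrinsic-tilt, exact-restriction
- Literature.Barriers.CriticalPhenomena.PlanarEdwardsModelDiffusive: EVADED BY RELEVANCE, explicitly
— the barrier (Lawler1991 Prop 6.4.1/(6.7), Varadhan: e^{−βJ̄} has bounded fluctuations, the planar
Edwards tilt is absolutely continuous w.r.t. Wiener, ν = 1/2 at fixed coupling) concerns the
intersection-PAIR functional, marginal in d = 2; blob time charges every unit of time inside a loop,
its residual operator has dimension 3/4 > 0, p(λ) > 0 for every λ > 0 (e^{λC_n} is not a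
bounded-fluctuation energy) and the tilt is singular w.r.t. the excursion at large scales for every
g > 0 — a different functional outside the barrier's class; the window regime where absolute
continuity does hold (fixed g, bounded domain) is used as the UV anchor, not fought.
- Literature.Barriers.CriticalPhenomena.SAWNotKineticallyGrown: BL_t is Gibbsian (a weight on whole
paths), no growth kernel or consistency in n is used; the barrier's dichotomy (consistent local
growth ⇒ locality, κ = 6) is not touched.
- Literature.Barriers.CriticalPhenomena.SupercriticalSAWSpaceFilling: every law sits AT the
whole-plane critical fugacity y_c(t) (t = 0: exactly x_c); no statement is open in the fugacity; the
continuum shadow (mass escaping to dense paths if the effective killing drifts below θ_c(g) by an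
amount growing with the scale) is the declared failure mode of CutPointWindowLimit, and a bounded
offset is harmless by zoom covariance.

History (route lifecycle, newest last):
- 2026-08-22T04:35:51Z · DORMANT — reconciler: no traction for 5.1 d (last activity item-evidence-added at 2026-08-17T02:24:27Z); parked, not closed — `ledger route dormant route-CriticalPhenomen (operator:999:3577873)

sub-problem: SAWScalingLimit · status: dormant · opened planner-plancard-CriticalPhenomena-SAWScaling-d5118ad0-0 2026-08-15T12:08:26Z · rev 2 · ledger route-CriticalPhenomena-SAWCutPointCondensation
GENERATED by the gate from the ledger (D-0016/17). Provers cite these decls: `theorem foo : Summit.CriticalPhenomena.SAWScalingLimit.Theses.SAWCutPointCondensation.<Decl> := …` in Summits/CriticalPhenomena/SAWScalingLimit/Theorems/<Name>.lean.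
-/

namespace Summit.CriticalPhenomena.SAWScalingLimit.Theses.SAWCutPointCondensation

open scoped BigOperators Topology Manifold Classical MeasureTheory ProbabilityTheory Matrix InnerProductSpace ComplexConjugate ContinuousMap
open Filter Set Function TopologicalSpace MeasureTheory

attribute [summit_statement] _root_.SAWScalingLimit

/-- item stmt-CriticalPhenomena-7346 · crux · rank 2 · open · by planner
why it might fail: A 'beaded' intermediate fixed point: macroscopic blobs could survive g → ∞ (no lattice cutoff prices a blob at a definite amount); tightness/simplicity uniform in g may fail (KS crossing bounds unproved even for SAW); restriction must pass two weak limits (∂{γ ⊆ D̄'} may carry mass).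
sources: Virag2003, LawlerSchrammWerner2003Restriction, Werner2005ConformalRestriction, KemppainenSmirnov2017, MadrasSlade1993, HoldenLawlerLiSun2022
[crux] (card r2, CONDENSATION = existence of the strong-coupling limit) For every family Q : ℝ →
ChordalFamily such that, for each g > 0, Q g is chordal (ChordalFamily.IsChordal) and is the δ → 0+
weak limit (TendstoLaw, identity random variable) of the critical blob-time laws
BL_{exp(−gδ^{3/4})}(Ω_δ; a_δ, b_δ) for every Dobrushin domain and every endpoint approximation
(Literature.Probability.RandomPlanarGeometry.SAW.IsEndpointApprox) — i.e. Q is the window family of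
CutPointWindowLimit — there is a chordal family P with the two-sided restriction property
(ChordalFamily.IsRestriction), carried by simple curves meeting ∂D only at a, b (CurveClass.simple,
range ∩ frontier D ⊆ {a, b}), such that Q g D → P D weakly as g → ∞ (bounded continuous test
functions) on every approximable Dobrushin domain. 'Reward the cut points until they condense: the
blobs between consecutive cut points die in the infrared.' Tools foreseen: exact restriction at
every g (lattice identity passed to the window limit); zoom = flow (Q_g on R·D is the R-image of
Q_{R^{3/4}g} on D, so g → ∞ in D is the large-domain limit at fixed g); Virág's bead decomposition
of the excursion at its cut times (tilting by cut loc -/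
@[route_item "route-CriticalPhenomena-SAWCutPointCondensation", crux]
def CondensationLimit : Prop :=
  ∀ Q : ℝ → Literature.Probability.RandomPlanarGeometry.ChordalFamily, (∀ g : ℝ, 0 < g → (Q g).IsChordal ∧ ∀ (D : Literature.Probability.RandomPlanarGeometry.DobrushinDomain) (a b : ℝ → Literature.Probability.LatticeModels.Site 2), Literature.Probability.RandomPlanarGeometry.SAW.IsEndpointApprox D a b → Literature.Probability.RandomPlanarGeometry.TendstoLaw (fun (_ : ℝ) (x : Literature.Probability.RandomPlanarGeometry.CurveClass ℂ) => x) (fun δ => ((fun S : MeasureTheory.Measure (Literature.Probability.RandomPlanarGeometry.CurveClass ℂ) => (S Set.univ)⁻¹ • S) (MeasureTheory.Measure.sum fun p : (Literature.Probability.LatticeModels.discreteDomainGraph D.carrier δ).Walk (a δ) (b δ) => ENNReal.ofReal ((⨅ n : ℕ, (∑ v ∈ Literature.Probability.LatticeModels.box 2 (n + 1), ∑ q ∈ (Literature.Probability.LatticeModels.zdGraph 2).finsetWalkLength (n + 1) (0 : Literature.Probability.LatticeModels.Site 2) v, (Real.exp (-(g * δ ^ (3 / 4 : ℝ)))) ^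 (q.length - ((Finset.range q.length).filter fun j => ∀ i ∈ Finset.range (j + 1), ∀ k ∈ Finset.Ioc j q.length, q.getVert i ≠ q.getVert k).card)) ^ (1 / ((n : ℝ) + 1)))⁻¹ ^ p.length * (Real.exp (-(g * δ ^ (3 / 4 : ℝ)))) ^ (p.length - ((Finset.range p.length).filter fun j => ∀ i ∈ Finset.range (j + 1), ∀ k ∈ Finset.Ioc j p.length, p.getVert i ≠ p.getVert k).card)) • MeasureTheory.Measure.dirac (Literature.Probability.RandomPlanarGeometry.CurveClass.mk ⟨p.toCurve (Literature.Probability.LatticeModels.meshPoint δ)⟩)))) id ((Q g) D)) → ∃ P : Literature.Probability.RandomPlanarGeometry.ChordalFamily, P.IsChordal ∧ P.IsRestriction ∧ (∀ D : Literature.Probability.RandomPlanarGeometry.DobrushinDomain, ∀ᵐ γ ∂(P D), γ ∈ Literature.Probability.RandomPlanarGeometry.CurveClass.simple ∧ γ.range ∩ frontier D.carrier ⊆ {D.pt 0, D.pt 1}) ∧ (∀ (D : Literature.Probability.RandomPlanarGeometry.DobrushinDomain) (a b : ℝ → Literature.Probability.LatticeModels.Site 2), Literature.Probability.RandomPlanarGeometry.SAW.IsEndpointApprox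 D a b → ∀ f : BoundedContinuousFunction (Literature.Probability.RandomPlanarGeometry.CurveClass ℂ) ℝ, Filter.Tendsto (fun g : ℝ => ∫ x, f x ∂(Q g D)) Filter.atTop (nhds (∫ x, f x ∂(P D))))

/-- item stmt-CriticalPhenomena-7347 · crux · rank 3 · open · by planner
why it might fail: |ψ′| degenerates at rough prime ends and at a, b, outside bounded-profile universality; a marginal stress-tensor-type response to ∇log ρ could survive g → ∞ and leave a profile memory, so the limit would be restriction-covariant but not conformally covariant.
sources: LawlerSchrammWerner2004SAW, HoldenLawlerLiSun2022, Lawler2005ConformallyInvariant, Virag2003, Literature.Barriers.CriticalPhenomena.ScaleCovarianceNotMoebius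
[crux] (card r2, covariance half = bare-coupling irrelevance at the infrared end) For every window
family Q (as in CondensationLimit) and every chordal P with the restriction property, carried by
simple curves meeting ∂D only at a, b, such that Q g D → P D weakly as g → ∞ on every approximable
Dobrushin domain: P is conformally covariant (ChordalFamily.IsConformallyCovariant). Intended proof:
conformal invariance of the Brownian excursion, covariance of the cut-point content (d𝓜′ =
|φ′|^{3/4} d𝓜) and of duration (dτ′ = |φ′|² dτ) make the POINTWISE-CRITICAL inhomogeneous tilts
exp(∫ gρ d𝓜 − κ₀ ∫ (gρ)^{8/3} dτ)·(excursion law) a conformally CLOSED class — exactly, with no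
counterterm, since (3/4)·(8/3) = 2 turns the profile ρ = |ψ′|^{3/4} of the coupling into the profile
|ψ′|² of the killing — so covariance of the strong-coupling limit IS profile universality: lim_{g→∞}
of the ρ-modulated family equals lim_{g→∞} of the constant one for log-harmonic ρ bounded above and
below on compacts (plus exact restriction to localise away from rough prime ends). The bare value of
a RELEVANT coupling sets only the local crossover scale (gρ)^{−4/3} → 0 and is forgotten in the
infrared. [deps: CutPo -/
@[route_item "route-CriticalPhenomena-SAWCutPointCondensation", crux]
def CondensateCovariance : Prop :=
  ∀ (Q : ℝ → Literature.Probability.RandomPlanarGeometry.ChordalFamily) (P : Literature.Probability.RandomPlanarGeometry.ChordalFamily), (∀ g : ℝ, 0 < g → (Q g).IsChordal ∧ ∀ (D : Literature.Probability.RandomPlanarGeometry.DobrushinDomain) (a b : ℝ → Literature.Probability.LatticeModels.Site 2), Literature.Probability.RandomPlanarGeometry.SAW.IsEndpointApprox D a b → Literature.Probability.RandomPlanarGeometry.TendstoLaw (fun (_ : ℝ) (x : Literature.Probability.RandomPlanarGeometry.CurveClass ℂ) => x) (fun δ => ((fun S : MeasureTheory.Measure (Literature.Probability.RandomPlanarGeometry.CurveClass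 ℂ) => (S Set.univ)⁻¹ • S) (MeasureTheory.Measure.sum fun p : (Literature.Probability.LatticeModels.discreteDomainGraph D.carrier δ).Walk (a δ) (b δ) => ENNReal.ofReal ((⨅ n : ℕ, (∑ v ∈ Literature.Probability.LatticeModels.box 2 (n + 1), ∑ q ∈ (Literature.Probability.LatticeModels.zdGraph 2).finsetWalkLength (n + 1) (0 : Literature.Probability.LatticeModels.Site 2) v, (Real.exp (-(g * δ ^ (3 / 4 : ℝ)))) ^ (q.length - ((Finset.range q.length).filter fun j => ∀ i ∈ Finset.range (j + 1), ∀ k ∈ Finset.Ioc j q.length, q.getVert i ≠ q.getVert k).card)) ^ (1 / ((n : ℝ) + 1)))⁻¹ ^ p.length * (Real.exp (-(g * δ ^ (3 / 4 : ℝ)))) ^ (p.length - ((Finset.range p.length).filter fun j => ∀ i ∈ Finset.range (j + 1), ∀ k ∈ Finset.Ioc j p.length, p.getVert i ≠ p.getVert k).card)) • MeasureTheory.Measure.dirac (Literature.Probability.RandomPlanarGeometry.CurveClass.mk ⟨p.toCurve (Literature.Probability.LatticeModels.meshPoint δ)⟩)))) id ((Q g) D)) → P.IsChordal → P.IsRestriction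 → (∀ D : Literature.Probability.RandomPlanarGeometry.DobrushinDomain, ∀ᵐ γ ∂(P D), γ ∈ Literature.Probability.RandomPlanarGeometry.CurveClass.simple ∧ γ.range ∩ frontier D.carrier ⊆ {D.pt 0, D.pt 1}) → (∀ (D : Literature.Probability.RandomPlanarGeometry.DobrushinDomain) (a b : ℝ → Literature.Probability.LatticeModels.Site 2), Literature.Probability.RandomPlanarGeometry.SAW.IsEndpointApprox D a b → ∀ f : BoundedContinuousFunction (Literature.Probability.RandomPlanarGeometry.CurveClass ℂ) ℝ, Filter.Tendsto (fun g : ℝ => ∫ x, f x ∂(Q g D)) Filter.atTop (nhds (∫ x, f x ∂(P D)))) → P.IsConformallyCovariant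

/-- item stmt-CriticalPhenomena-7348 · crux · rank 4 · open · by planner
why it might fail: A double limit across the whole crossover: fixed t ∈ (0,1) is folklore-level open (like fixed-λ Domb–Joyce, BDGS2012 (1.28)); a log-slow window could behave differently; any RW-vs-SAW modulus renormalisation surviving on ℤ² refutes it exactly as typed.
sources: BDGS2012, KennedyLawler2013, LawlerSchrammWerner2004SAW, MadrasSlade1993, Literature.Barriers.CriticalPhenomena.EmbeddingModulusUniqueness
[crux] (card r4, COMMUTATION, stated on the lattice) For every Dobrushin domain, endpoint
approximation and two blob-fugacity schedules t₁ t₂ : ℝ → ℝ with, eventually along δ → 0+, t_i(δ) ∈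
[0,1] and, for every M, eventually t_i(δ) ≤ exp(−Mδ^{3/4}) (the effective window coupling −log
t_i(δ)/δ^{3/4} diverges: fixed t ∈ [0,1), slowly closing windows, and t ≡ 0 = the self-avoiding walk
itself, with no Real.log so that t = 0 is a genuine member), the critical blob-time laws BL_{t₁(δ)}
and BL_{t₂(δ)} in (Ω_δ; a_δ, b_δ) are asymptotically equal in law: ∫ f dBL_{t₁(δ)} − ∫ f dBL_{t₂(δ)}
→ 0 for every bounded continuous f on CurveClass ℂ. 'Any positive price per unit of blob time flows
to the self-avoiding walk, and the lattice adds nothing between the window and t = 0': lim_δ SAW.law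
= lim_g lim_δ (window). On graphs whose RW-modulus differs from the SAW-modulus this is false (card
random-walk-ruler-needs-d4), so the content is 'no D₄-invariant marginal operator is generated below
the window'; on ℤ² the quarter-turn forbids the spin-2 one. [difficulty: open-problem] -/
@[route_item "route-CriticalPhenomena-SAWCutPointCondensation", crux]
def PenaltyUniversality : Prop :=
  ∀ (D : Literature.Probability.RandomPlanarGeometry.DobrushinDomain) (a b : ℝ → Literature.Probability.LatticeModels.Site 2), Literature.Probability.RandomPlanarGeometry.SAW.IsEndpointApprox D a b → ∀ t₁ t₂ : ℝ → ℝ, Filter.Eventually (fun δ => t₁ δ ∈ Set.Icc (0 : ℝ) 1 ∧ t₂ δ ∈ Set.Icc (0 : ℝ) 1) (nhdsWithin 0 (Set.Ioi 0)) → (∀ M : ℝ, Filter.Eventually (fun δ => t₁ δ ≤ Real.exp (-(M * δ ^ (3 / 4 : ℝ)))) (nhdsWithin 0 (Set.Ioi 0))) → (∀ M : ℝ, Filter.Eventually (fun δ => t₂ δ ≤ Real.exp (-(M * δ ^ (3 / 4 : ℝ)))) (nhdsWithin 0 (Set.Ioi 0))) → ∀ f : BoundedContinuousFunction (Literature.Probability.RandomPlanarGeometry.CurveClass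 ℂ) ℝ, Filter.Tendsto (fun δ => (∫ x, f x ∂((fun S : MeasureTheory.Measure (Literature.Probability.RandomPlanarGeometry.CurveClass ℂ) => (S Set.univ)⁻¹ • S) (MeasureTheory.Measure.sum fun p : (Literature.Probability.LatticeModels.discreteDomainGraph D.carrier δ).Walk (a δ) (b δ) => ENNReal.ofReal ((⨅ n : ℕ, (∑ v ∈ Literature.Probability.LatticeModels.box 2 (n + 1), ∑ q ∈ (Literature.Probability.LatticeModels.zdGraph 2).finsetWalkLength (n + 1) (0 : Literature.Probability.LatticeModels.Site 2) v, (t₁ δ) ^ (q.length - ((Finset.range q.length).filter fun j => ∀ i ∈ Finset.range (j + 1), ∀ k ∈ Finset.Ioc j q.length, q.getVert i ≠ q.getVert k).card)) ^ (1 / ((n : ℝ) + 1)))⁻¹ ^ p.length * (t₁ δ) ^ (p.length - ((Finset.range p.length).filter fun j => ∀ i ∈ Finset.range (j + 1), ∀ k ∈ Finset.Ioc j p.length, p.getVert i ≠ p.getVert k).card)) • MeasureTheory.Measure.dirac (Literature.Probability.RandomPlanarGeometry.CurveClass.mk ⟨p.toCurve (Literature.Probability.LatticeModels.meshPoint δ)⟩))))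 - ∫ x, f x ∂((fun S : MeasureTheory.Measure (Literature.Probability.RandomPlanarGeometry.CurveClass ℂ) => (S Set.univ)⁻¹ • S) (MeasureTheory.Measure.sum fun p : (Literature.Probability.LatticeModels.discreteDomainGraph D.carrier δ).Walk (a δ) (b δ) => ENNReal.ofReal ((⨅ n : ℕ, (∑ v ∈ Literature.Probability.LatticeModels.box 2 (n + 1), ∑ q ∈ (Literature.Probability.LatticeModels.zdGraph 2).finsetWalkLength (n + 1) (0 : Literature.Probability.LatticeModels.Site 2) v, (t₂ δ) ^ (q.length - ((Finset.range q.length).filter fun j => ∀ i ∈ Finset.range (j + 1), ∀ k ∈ Finset.Ioc j q.length, q.getVert i ≠ q.getVert k).card)) ^ (1 / ((n : ℝ) + 1)))⁻¹ ^ p.length * (t₂ δ) ^ (p.length - ((Finset.range p.length).filter fun j => ∀ i ∈ Finset.range (j + 1), ∀ k ∈ Finset.Ioc j p.length, p.getVert i ≠ p.getVert k).card)) • MeasureTheory.Measure.dirac (Literature.Probability.RandomPlanarGeometry.CurveClass.mk ⟨p.toCurve (Literature.Probability.LatticeModels.meshPoint δ)⟩)))) (nhdsWithin 0 (Set.Ioi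 0)) (nhds 0)

/-- item stmt-CriticalPhenomena-7349 · crux · rank 5 · open · by planner
why it might fail: GLPS: walk stopped in a disc, polynomial moments; here an EXPONENTIAL tilt e^{gν} of an excursion pinned at prime ends at exact whole-plane criticality y_c(t): if p(λ) ≁ λ^{8/3} or uniform exponential moments fail, mass escapes to long/short walks and no chordal limit exists.
sources: GaoLiPanovShiraishi2026, HoldenLawlerLiSun2022, Lawler1996CutTimes, LawlerSchrammWerner2001PlaneExponents, Virag2003, arXiv:2310.09592
[crux] (card r3, WINDOW — the construction statement positing the continuum window family through
its lattice characterisation; weak limits on the Polish space CurveClass ℂ are unique) For every g >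
0 there is a chordal family Q_g (probability laws carried by curves in D̄ from a to b) such that for
every Dobrushin domain (Ω; a, b) and every endpoint approximation the critical blob-time law with
fugacity t = exp(−g δ^{3/4}) — weight y_c(t)^{|p|} t^{B(p)} on ALL nearest-neighbour walks p of Ω_δ
from a_δ to b_δ (y_c(t) = 1/μ_B(t) the whole-plane critical fugacity), normalised and pushed to
curves — converges weakly to Q_g(D) as δ → 0+. Intended identification (once the
excursion/cut-content definitions exist): Q_g(D) ∝ exp(g c₁ 𝓜_{3/4}(cut points of ω) − θ_c(g) τ(ω))
· μ^{exc}_{D;a,b}(dω) with θ_c(g) = κ₀ g^{8/3} the whole-plane critical killing rate; inputs in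
print: KMT/Skorokhod coupling, GaoLiPanovShiraishi2026 Thm 1.1–1.3 (ε^{3/4}·Σ_{cut points} δ_x of
the SRW stopped on leaving the disc → the Minkowski-content measure of the Brownian cut points,
weakly in law and in L² under the coupling), HoldenLawlerLiSun2022 (the content exists, non-atomic),
Lawler1996CutTimes Thm 1.3 (non-in -/
@[route_item "route-CriticalPhenomena-SAWCutPointCondensation", crux]
def CutPointWindowLimit : Prop :=
  ∀ g : ℝ, 0 < g → ∃ Q : Literature.Probability.RandomPlanarGeometry.ChordalFamily, Q.IsChordal ∧ ∀ (D : Literature.Probability.RandomPlanarGeometry.DobrushinDomain) (a b : ℝ → Literature.Probability.LatticeModels.Site 2), Literature.Probability.RandomPlanarGeometry.SAW.IsEndpointApprox D a b → Literature.Probability.RandomPlanarGeometry.TendstoLaw (fun (_ : ℝ) (x : Literature.Probability.RandomPlanarGeometry.CurveClass ℂ) => x) (fun δ => ((fun S : MeasureTheory.Measure (Literature.Probability.RandomPlanarGeometry.CurveClass ℂ) => (S Set.univ)⁻¹ • S) (MeasureTheory.Measure.sum fun p : (Literature.Probability.LatticeModels.discreteDomainGraph D.carrier δ).Walk (a δ)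 (b δ) => ENNReal.ofReal ((⨅ n : ℕ, (∑ v ∈ Literature.Probability.LatticeModels.box 2 (n + 1), ∑ q ∈ (Literature.Probability.LatticeModels.zdGraph 2).finsetWalkLength (n + 1) (0 : Literature.Probability.LatticeModels.Site 2) v, (Real.exp (-(g * δ ^ (3 / 4 : ℝ)))) ^ (q.length - ((Finset.range q.length).filter fun j => ∀ i ∈ Finset.range (j + 1), ∀ k ∈ Finset.Ioc j q.length, q.getVert i ≠ q.getVert k).card)) ^ (1 / ((n : ℝ) + 1)))⁻¹ ^ p.length * (Real.exp (-(g * δ ^ (3 / 4 : ℝ)))) ^ (p.length - ((Finset.range p.length).filter fun j => ∀ i ∈ Finset.range (j + 1), ∀ k ∈ Finset.Ioc j p.length, p.getVert i ≠ p.getVert k).card)) • MeasureTheory.Measure.dirac (Literature.Probability.RandomPlanarGeometry.CurveClass.mk ⟨p.toCurve (Literature.Probability.LatticeModels.meshPoint δ)⟩)))) id (Q D)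

/-- item stmt-CriticalPhenomena-7350 · crux · rank 6 · open · by planner
why it might fail: Upper bound needs k-point cut-time bounds with C^k·k!-type constants (Lawler1996CutTimes: k ≤ 2; GLPS2026 Prop 5.1: fixed k) for uniform exponential moments of C_n/n^{3/8}; lower bound needs cut density ≍ v^{5/4} under drift v; a log correction to E C_n ≍ n^{3/8} under tilt breaks the pure 8/3.
sources: Lawler1996CutTimes, LawlerSchrammWerner2001PlaneExponents, GaoLiPanovShiraishi2026, Lawler1991
[crux] (card r5(b): the relevance exponent as a theorem about planar simple random walk; calibrates
the window δ^{3/4} of CutPointWindowLimit and is the line's cheapest analytic test) The cut-time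
free energy p(λ) := lim_n n⁻¹ log E_SRW[e^{λ C_n}] (C_n = #cut times of the n-step walk; exists by
submultiplicativity) equals log(μ_B(t)/(4t)) at t = e^{−λ} and satisfies p ≍ λ^{8/3} at 0+: there
are c, C, ε > 0 with c(1−t)^{8/3} ≤ log(μ_B(t)/(4t)) ≤ C(1−t)^{8/3} for all t ∈ (1−ε, 1). Here 8/3 =
2/y, y = 3/4 = 2 − ξ(1,1): the correlation TIME of the reward λ is λ^{−8/3}. Upper bound ⇐ SOME
exponential moment of C_n/n^{3/8} bounded uniformly in n (k-point bounds of the Lawler1996CutTimes /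
GaoLiPanovShiraishi2026 Prop 5.1 type) + submultiplicativity E e^{λC_{n+m}} ≤ E e^{λC_n} E e^{λC_m},
choosing n₀ = (s₀/λ)^{8/3}; lower bound ⇐ a drift strategy (speed v costs ≍ v² per step in entropy
and produces cut-time density ≍ v^{2ζ} = v^{5/4}, so the rate function of the cut density obeys I(c)
≲ c^{8/5}, Legendre-dual to 8/3). Endpoint check: μ_B(0) = μ, i.e. I(1) = log(4/μ). [difficulty: L] -/
@[route_item "route-CriticalPhenomena-SAWCutPointCondensation"]
def FreeEnergyScaling : Prop :=
  ∃ c C ε : ℝ, 0 < c ∧ 0 < C ∧ 0 < ε ∧ ∀ t : ℝ, t ∈ Set.Ioo (1 - ε) 1 → c * (1 - t) ^ (8 / 3 : ℝ) ≤ Real.log ((⨅ n : ℕ, (∑ v ∈ Literature.Probability.LatticeModels.box 2 (n + 1), ∑ q ∈ (Literature.Probability.LatticeModels.zdGraph 2).finsetWalkLength (n + 1) (0 : Literature.Probability.LatticeModels.Site 2) v, (t) ^ (q.length - ((Finset.range q.length).filter fun j => ∀ i ∈ Finset.range (j + 1), ∀ k ∈ Finset.Ioc j q.length, q.getVert i ≠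 q.getVert k).card)) ^ (1 / ((n : ℝ) + 1))) / (4 * t)) ∧ Real.log ((⨅ n : ℕ, (∑ v ∈ Literature.Probability.LatticeModels.box 2 (n + 1), ∑ q ∈ (Literature.Probability.LatticeModels.zdGraph 2).finsetWalkLength (n + 1) (0 : Literature.Probability.LatticeModels.Site 2) v, (t) ^ (q.length - ((Finset.range q.length).filter fun j => ∀ i ∈ Finset.range (j + 1), ∀ k ∈ Finset.Ioc j q.length, q.getVert i ≠ q.getVert k).card)) ^ (1 / ((n : ℝ) + 1))) / (4 * t)) ≤ C * (1 - t) ^ (8 / 3 : ℝ)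

/-- item stmt-CriticalPhenomena-4655 · support · rank 9 · closed · proved by Summit.CriticalPhenomena.SAWScalingLimit.Theorems.scheduleExtraction_proof (prover) · by planner
sources: Billingsley1999, Mathlib (MeasureTheory.LevyProkhorov instMetrizableSpaceProbabilityMeasure)
[support] Diagonal schedule for iterated weak limits on CurveClass ℂ: if F g δ ∈ {0} ∪ {probability
measures}, F g δ ⇒ A g as δ → 0+ for every g > 0 (bounded continuous test functions), A g
probability, and A g ⇒ P as g → ∞ (P probability), then there is a schedule gs : ℝ → ℝ with gs δ → ∞
as δ → 0+ and F (gs δ) δ ⇒ P. Proof: weak convergence of probability measures on the Polish space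
CurveClass ℂ is metrisable (Lévy–Prokhorov, Mathlib `MeasureTheory.LevyProkhorov`); F g δ is
eventually a probability measure (test f ≡ 1); choose thresholds δ_k ↓ 0 along the countably
generated filter 𝓝[>]0. PLANNER-VERIFIED: sorry-free proof `scheduleExtraction_holds :
ScheduleExtraction` (≈ 130 lines: ProbabilityMeasure lifts, tendsto_iff_forall_integral_tendsto, (𝓝
p).exists_antitone_basis via Mathlib's instMetrizableSpaceProbabilityMeasure, nhdsGT_basis,
Nat.sSup_mem; axioms standard) attached as evidence (ScheduleProof.lean) — transplant into
Theorems/. [difficulty: provable-now] -/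
@[route_item "route-CriticalPhenomena-SAWCutPointCondensation", crux]
def ScheduleExtraction : Prop :=
  ∀ (F : ℝ → ℝ → MeasureTheory.Measure (Literature.Probability.RandomPlanarGeometry.CurveClass ℂ)) (A : ℝ → MeasureTheory.Measure (Literature.Probability.RandomPlanarGeometry.CurveClass ℂ)) (P : MeasureTheory.Measure (Literature.Probability.RandomPlanarGeometry.CurveClass ℂ)), (∀ g : ℝ, 0 < g → MeasureTheory.IsProbabilityMeasure (A g)) → MeasureTheory.IsProbabilityMeasure P → (∀ g δ : ℝ, F g δ = 0 ∨ MeasureTheory.IsProbabilityMeasure (F g δ)) → (∀ g : ℝ, 0 < g → ∀ f : BoundedContinuousFunction (Literature.Probability.RandomPlanarGeometry.CurveClass ℂ) ℝ, Filter.Tendsto (fun δ => ∫ x, f x ∂(F g δ)) (nhdsWithin 0 (Set.Ioi 0)) (nhds (∫ x, f x ∂(A g)))) → (∀ f : BoundedContinuousFunction (Literature.Probability.RandomPlanarGeometry.CurveClass ℂ) ℝ, Filter.Tendsto (fun g => ∫ x, f x ∂(A g)) Filter.atTop (nhds (∫ x, f x ∂P))) → ∃ gs : ℝ → ℝ, Filter.Tendsto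 gs (nhdsWithin 0 (Set.Ioi 0)) Filter.atTop ∧ ∀ f : BoundedContinuousFunction (Literature.Probability.RandomPlanarGeometry.CurveClass ℂ) ℝ, Filter.Tendsto (fun δ => ∫ x, f x ∂(F (gs δ) δ)) (nhdsWithin 0 (Set.Ioi 0)) (nhds (∫ x, f x ∂P))

/-- item stmt-CriticalPhenomena-7351 · support · rank 9 · closed · proved by Summit.CriticalPhenomena.SAWScalingLimit.Theorems.blobZeroIsSAW_proof (prover) · by planner
sources: LawlerSchrammWerner2004SAW, BDGS2012
[support] At t = 0 the inlined critical blob-time law IS the conjunct's law pushed to curves: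
BL_0(Ω_δ; a, b) = (SAW.law Ω δ a b).map (·.curve) for all Ω, δ, a, b. Proof: B(p) = 0 ↔ every j <
|p| is a cut time ↔ p.getVert injective on [0, |p|] ↔ p.IsPath; hence (0:ℝ)^{B(p)} = 𝟙{IsPath},
b_n(0) = (count n : ℝ), μ_B(0) = SAW.connectiveConstant and y_c(0) = criticalFugacity
definitionally; reindex Measure.sum over {p // p.IsPath} ≃ DomainSAW Ω δ a b (terms with ¬IsPath
vanish), map commutes with sum/smul/dirac; junk cases agree since total masses coincide (cf.
SAWEdwardsStrongCoupling.WeaklyOneIsSAW, planner-proved there). [difficulty: provable-now] -/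
@[route_item "route-CriticalPhenomena-SAWCutPointCondensation", crux]
def BlobZeroIsSAW : Prop :=
  ∀ (Ω : Set ℂ) (δ : ℝ) (a b : Literature.Probability.LatticeModels.Site 2), ((fun S : MeasureTheory.Measure (Literature.Probability.RandomPlanarGeometry.CurveClass ℂ) => (S Set.univ)⁻¹ • S) (MeasureTheory.Measure.sum fun p : (Literature.Probability.LatticeModels.discreteDomainGraph Ω δ).Walk a b => ENNReal.ofReal ((⨅ n : ℕ, (∑ v ∈ Literature.Probability.LatticeModels.box 2 (n + 1), ∑ q ∈ (Literature.Probability.LatticeModels.zdGraph 2).finsetWalkLength (n + 1) (0 : Literature.Probability.LatticeModels.Site 2) v, ((0 : ℝ)) ^ (q.length - ((Finset.range q.length).filter fun j => ∀ i ∈ Finset.range (j + 1), ∀ k ∈ Finset.Ioc j q.length, q.getVert i ≠ q.getVert k).card)) ^ (1 / ((n : ℝ) + 1)))⁻¹ ^ p.length * ((0 : ℝ)) ^ (p.length - ((Finset.range p.length).filter fun j => ∀ i ∈ Finset.range (j + 1), ∀ k ∈ Finset.Ioc j p.length, p.getVert i ≠ p.getVert k).card)) • MeasureTheory.Measure.dirac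 (Literature.Probability.RandomPlanarGeometry.CurveClass.mk ⟨p.toCurve (Literature.Probability.LatticeModels.meshPoint δ)⟩))) = (Literature.Probability.RandomPlanarGeometry.SAW.law Ω δ a b).map (fun γ => γ.curve)

/-- item stmt-CriticalPhenomena-7352 · support · rank 9 · closed · proved by Summit.CriticalPhenomena.SAWScalingLimit.Theorems.blobLawDichotomy_proof (prover) · by planner
sources: BDGS2012, folklore (Mathlib ENNReal.inv_top / ENNReal.inv_mul_cancel)
[support] The inlined law (S univ)⁻¹ • S is either the zero measure (S univ ∈ {0, ∞}) or a
probability measure, for every real t and all Ω, δ, a, b — pure ENNReal normalisation algebra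
(ENNReal.inv_top, ENNReal.inv_mul_cancel); the same 10-line generic lemma closes
SAWEdwardsStrongCoupling.WindowLawDichotomy. (For t ∈ [0,1], bounded Ω and δ > 0 the total mass is
in fact finite and, once a, b are joined, positive: #cut times ≤ |V(Ω_δ)| gives weight ≤
t^{−|V|}(t·y_c(t))^{|p|} with t·y_c(t) ≤ 1/4 < 1/λ₁(Ω_δ).) [difficulty: provable-now] -/
@[route_item "route-CriticalPhenomena-SAWCutPointCondensation", crux]
def BlobLawDichotomy : Prop :=
  ∀ (t : ℝ) (Ω : Set ℂ) (δ : ℝ) (a b : Literature.Probability.LatticeModels.Site 2), ((fun S : MeasureTheory.Measure (Literature.Probability.RandomPlanarGeometry.CurveClass ℂ) => (S Set.univ)⁻¹ • S) (MeasureTheory.Measure.sum fun p : (Literature.Probability.LatticeModels.discreteDomainGraph Ω δ).Walk a b => ENNReal.ofReal ((⨅ n : ℕ, (∑ v ∈ Literature.Probability.LatticeModels.box 2 (n + 1), ∑ q ∈ (Literature.Probability.LatticeModels.zdGraph 2).finsetWalkLength (n + 1) (0 : Literature.Probability.LatticeModels.Site 2) v, (t) ^ (q.length - ((Finset.range q.length).filter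 fun j => ∀ i ∈ Finset.range (j + 1), ∀ k ∈ Finset.Ioc j q.length, q.getVert i ≠ q.getVert k).card)) ^ (1 / ((n : ℝ) + 1)))⁻¹ ^ p.length * (t) ^ (p.length - ((Finset.range p.length).filter fun j => ∀ i ∈ Finset.range (j + 1), ∀ k ∈ Finset.Ioc j p.length, p.getVert i ≠ p.getVert k).card)) • MeasureTheory.Measure.dirac (Literature.Probability.RandomPlanarGeometry.CurveClass.mk ⟨p.toCurve (Literature.Probability.LatticeModels.meshPoint δ)⟩))) = 0 ∨ MeasureTheory.IsProbabilityMeasure ((fun S : MeasureTheory.Measure (Literature.Probability.RandomPlanarGeometry.CurveClass ℂ) => (S Set.univ)⁻¹ • S) (MeasureTheory.Measure.sum fun p : (Literature.Probability.LatticeModels.discreteDomainGraph Ω δ).Walk a b => ENNReal.ofReal ((⨅ n : ℕ, (∑ v ∈ Literature.Probability.LatticeModels.box 2 (n + 1), ∑ q ∈ (Literature.Probability.LatticeModels.zdGraph 2).finsetWalkLength (n + 1) (0 : Literature.Probability.LatticeModels.Site 2) v, (t) ^ (q.length - ((Finset.range q.length).filter fun j => ∀ i ∈ Finset.range (j + 1),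 ∀ k ∈ Finset.Ioc j q.length, q.getVert i ≠ q.getVert k).card)) ^ (1 / ((n : ℝ) + 1)))⁻¹ ^ p.length * (t) ^ (p.length - ((Finset.range p.length).filter fun j => ∀ i ∈ Finset.range (j + 1), ∀ k ∈ Finset.Ioc j p.length, p.getVert i ≠ p.getVert k).card)) • MeasureTheory.Measure.dirac (Literature.Probability.RandomPlanarGeometry.CurveClass.mk ⟨p.toCurve (Literature.Probability.LatticeModels.meshPoint δ)⟩)))

/-- item stmt-CriticalPhenomena-7353 · support · rank 9 · closed · proved by Summit.CriticalPhenomena.SAWScalingLimit.Theorems.BlobCountSubmult_proof (prover) · by planner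
sources: BDGS2012, MadrasSlade1993
[support] Submultiplicativity of the whole-plane blob partition sums: b_{n+m}(t) ≤ b_n(t)·b_m(t) for
t ∈ [0,1] and all n, m (split an (n+m)-step walk from 0 at time n and translate the tail to the
origin — an injection; a cut time of the concatenation is a cut time of the piece containing it, so
B is superadditive and t^B submultiplicative on [0,1], including t = 0; endpoints of k-step walks
lie in box 2 k). Consequences for provers of the cruxes: μ_B(t) = lim b_n^{1/n} (Fekete, Mathlib
Subadditive.tendsto_lim), b_n(t) ≥ μ_B(t)^n, 4t ≤ μ_B(t) ≤ 4, μ_B(0) = μ: the critical fugacity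
y_c(t) is a genuine number in [1/4, 1/μ]. [difficulty: provable-now] -/
@[route_item "route-CriticalPhenomena-SAWCutPointCondensation"]
def BlobCountSubmult : Prop :=
  ∀ t : ℝ, t ∈ Set.Icc (0 : ℝ) 1 → ∀ n m : ℕ, (∑ v ∈ Literature.Probability.LatticeModels.box 2 (n + m), ∑ q ∈ (Literature.Probability.LatticeModels.zdGraph 2).finsetWalkLength (n + m) (0 : Literature.Probability.LatticeModels.Site 2) v, (t) ^ (q.length - ((Finset.range q.length).filter fun j => ∀ i ∈ Finset.range (j + 1), ∀ k ∈ Finset.Ioc j q.length, q.getVert i ≠ q.getVert k).card)) ≤ (∑ v ∈ Literature.Probability.LatticeModels.box 2 n, ∑ q ∈ (Literature.Probability.LatticeModels.zdGraph 2).finsetWalkLength n (0 : Literature.Probability.LatticeModels.Site 2) v, (t) ^ (q.length - ((Finset.range q.length).filter fun j => ∀ i ∈ Finset.range (j + 1), ∀ k ∈ Finset.Ioc j q.length, q.getVert i ≠ q.getVert k).card)) * (∑ v ∈ Literature.Probability.LatticeModels.box 2 m, ∑ q ∈ (Literature.Probability.LatticeModels.zdGraph 2).finsetWalkLength m (0 :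 Literature.Probability.LatticeModels.Site 2) v, (t) ^ (q.length - ((Finset.range q.length).filter fun j => ∀ i ∈ Finset.range (j + 1), ∀ k ∈ Finset.Ioc j q.length, q.getVert i ≠ q.getVert k).card))

/-- item stmt-CriticalPhenomena-7354 · assembly · rank 1 · closed · proved by Summit.CriticalPhenomena.SAWScalingLimit.Theorems.sawCutPointCondensation_assembly_proof (prover) · by planner
sources: LawlerSchrammWerner2003Restriction, LawlerSchrammWerner2004SAW
[assembly] ScheduleExtraction → BlobLawDichotomy → BlobZeroIsSAW → CutPointWindowLimit →
CondensationLimit → CondensateCovariance → PenaltyUniversality → SAWScalingLimit (the sub-problem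
constant `SAWScalingLimit` of Summits/CriticalPhenomena/SAWScalingLimit/Statement.lean; LSW03 enters
through the in-tree theorem LawlerSchrammWerner2003_holds inside the proof). -/
@[route_item "route-CriticalPhenomena-SAWCutPointCondensation"]
def Assembly : Prop :=
  ScheduleExtraction → BlobLawDichotomy → BlobZeroIsSAW → CutPointWindowLimit → CondensationLimit → CondensateCovariance → PenaltyUniversality → SAWScalingLimit

/-! D-0027 §2.1 — DECIDING THEOREM (planner-authored via `route open/edit --closes-file`; by planner-rbadge-CriticalPhenomena-SAWCutPointCo-996fc7c8-g4-0 2026-08-15T16:22:46Z):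
its hypotheses are this route's items and its conclusion the sub-problem Statement (glue_lint), and it elaborates with this file. -/

@[closes "route-CriticalPhenomena-SAWCutPointCondensation"] theorem closes (hSched : ScheduleExtraction) (hDich : BlobLawDichotomy) (hZero : BlobZeroIsSAW)
    (hW : CutPointWindowLimit) (hS : CondensationLimit) (hC : CondensateCovariance)
    (hU : PenaltyUniversality) : _root_.SAWScalingLimit := by
  intro D a b hab
  classical
  -- (W): choose the window family `Q g` for `g > 0` (junk `0` for `g ≤ 0`)
  choose Qf hQf using hW
  let Q : ℝ → Literature.Probability.RandomPlanarGeometry.ChordalFamily :=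
    fun g => if hg : 0 < g then Qf g hg else fun _ => 0
  have hQdef : ∀ (g : ℝ) (hg : 0 < g), Q g = Qf g hg := fun g hg => dif_pos hg
  -- (S): the strong-coupling limit `P` of the window family
  obtain ⟨P, hPch, hPres, hPsimp, hPlim⟩ :=
    hS Q (fun g hg => by rw [hQdef g hg]; exact hQf g hg)
  -- (C): `P` is conformally covariant
  have hPcov : P.IsConformallyCovariant :=
    hC Q P (fun g hg => by rw [hQdef g hg]; exact hQf g hg) hPch hPres hPsimp hPlim
  -- LSW 2003 (in-tree theorem): `P D` is the chordal SLE_{8/3} law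
  obtain ⟨Γ, hΓ, hPD⟩ :=
    Literature.Probability.RandomPlanarGeometry.LawlerSchrammWerner2003_holds P hPch hPcov hPres
      hPsimp D
  -- diagonal schedule `gs δ → ∞` along the window laws
  obtain ⟨gs, hgs, hlim⟩ :=
    hSched _ (fun g => Q g D) (P D)
      (fun g hg => by rw [hQdef g hg]; exact ((hQf g hg).1 D).1)
      (hPch D).1
      (fun g δ => hDich (Real.exp (-(g * δ ^ (3 / 4 : ℝ)))) D.carrier δ (a δ) (b δ))
      (fun g hg f => by rw [hQdef g hg]; exact (hQf g hg).2 D a b hab f)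
      (hPlim D a b hab)
  -- (U): the scheduled window law and the SAW law (`t ≡ 0`) are asymptotically equal
  have hIcc : ∀ᶠ δ in 𝓝[>] (0 : ℝ), Real.exp (-(gs δ * δ ^ (3 / 4 : ℝ))) ∈ Set.Icc (0 : ℝ) 1 ∧
      (0 : ℝ) ∈ Set.Icc (0 : ℝ) 1 := by
    filter_upwards [hgs.eventually_ge_atTop 0, self_mem_nhdsWithin] with δ hg hδ
    have hδ' : (0 : ℝ) < δ := hδ
    exact ⟨⟨(Real.exp_pos _).le, Real.exp_le_one_iff.2
      (neg_nonpos.2 (mul_nonneg hg (Real.rpow_nonneg hδ'.le _)))⟩, le_rfl, zero_le_one⟩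
  have hM1 : ∀ M : ℝ, ∀ᶠ δ in 𝓝[>] (0 : ℝ),
      Real.exp (-(gs δ * δ ^ (3 / 4 : ℝ))) ≤ Real.exp (-(M * δ ^ (3 / 4 : ℝ))) := by
    intro M
    filter_upwards [hgs.eventually_ge_atTop M, self_mem_nhdsWithin] with δ hg hδ
    have hδ' : (0 : ℝ) < δ := hδ
    exact Real.exp_le_exp.2 (neg_le_neg (mul_le_mul_of_nonneg_right hg (Real.rpow_nonneg hδ'.le _)))
  have hM2 : ∀ M : ℝ, ∀ᶠ δ in 𝓝[>] (0 : ℝ), (0 : ℝ) ≤ Real.exp (-(M * δ ^ (3 / 4 : ℝ))) :=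
    fun M => Filter.Eventually.of_forall fun δ => (Real.exp_pos _).le
  have hU' := hU D a b hab (fun δ => Real.exp (-(gs δ * δ ^ (3 / 4 : ℝ)))) (fun _ => (0 : ℝ))
    hIcc hM1 hM2
  -- assemble: SAW.law pushed to curves converges to `P D = law of Γ`
  refine ⟨Γ, hΓ, Filter.Eventually.of_forall fun δ =>
    Literature.Probability.RandomPlanarGeometry.SAW.aemeasurable_curve _ _ _ _, ?_⟩
  intro f
  have h1 := (hlim f).sub (hU' f)
  simp only [sub_sub_cancel, sub_zero] at h1
  rw [hPD, MeasureTheory.integral_map hΓ.aemeasurable f.continuous.aestronglyMeasurable] at h1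
  refine Filter.Tendsto.congr (fun δ => ?_) h1
  -- at each mesh: the `t = 0` blob-time law is `SAW.law` pushed to curves
  have hZ := hZero D.carrier δ (a δ) (b δ)
  beta_reduce at hZ
  rw [hZ, MeasureTheory.integral_map
    (Literature.Probability.RandomPlanarGeometry.SAW.aemeasurable_curve _ _ _ _)
    f.continuous.aestronglyMeasurable]

end Summit.CriticalPhenomena.SAWScalingLimit.Theses.SAWCutPointCondensation
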